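import Literature.AlgebraicGeometry.Morphisms.ProperGenericFibreDim
import Literature.AlgebraicGeometry.Motives.ProjBaseChangeAny
import Summits.ResolutionOfSingularities.ResolutionOfSingularities.Theorems.EquisingularLiftEquisingularLiftNatF102IsoOfCharts
import Summits.ResolutionOfSingularities.ResolutionOfSingularities.Theorems.EquisingularLiftEquisingularLiftNatRationalCarrierInfinite
import Summits.ResolutionOfSingularities.ResolutionOfSingularities.Theorems.EquisingularLiftEquisingularLiftNatModelStep
import Summits.ResolutionOfSingularities.ResolutionOfSingularities.Theorems.EquisingularLiftEquisingularLiftNatCentreCodimTwoAdapters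
import HarnessLib

/-!
# [OURS · L1 W4.5(b) · LINE (T-j)-PROOF] S5b conjunct (3) FROM conjunct (2): a morphism `C → ℙ¹_O` over `Spec O` that is INJECTIVE on
# the closed fibre maps the closed fibre ONTO the closed fibre of `ℙ¹_O`
# (F-102 `GenusZeroOverCompleteDVR_holds`, res-L1-w45b-lead-2 g3's skeleton v3 1683bb741349c142, brick S5 `exists_morphism_PP`, conjunct (3);
# crux `EquisingularLiftNatThree` = stmt-ResolutionOfSingularities-20148, residue (T-j))

res-D-pv-035 g9 (res-L1-w45b-plan-1 DESK DEAL 2026-08-27T22:07:21Z «S5b SHARE — conjuncts (2) and (3) … as theorems about ANY φ»; cut owned by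
res-L1-w45b-stub-3). OURS; NOT a statement of any manuscript; AI-written, weaker than expert review. No `sorry`; standard axioms; DEF-FREE.
`--supports stmt-ResolutionOfSingularities-20148 --as helper`.

WHAT. In the F-102 setting (`O` local with residue map `θ : O ↠ k`; `f : C → Spec O` PROPER; closed fibre `i : Ck → C` cartesian over
`Spec θ` with `Ck ≅ ℙ¹_{k'}`) let `φ : C → ℙ¹_O` be ANY morphism over `Spec O` (`φ ≫ toSpec = f`) whose fibres over the closed fibre of
`ℙ¹_O` have at most one point (conjunct (2), `hinj`). THEN `range (i ≫ φ) = (ℙ¹_O)_k` (conjunct (3), `hsurj`, VERBATIM the skeleton's text):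
**`range_comp_eq_closedFibre_of_subsingleton_fibres`**. So S5b needs the coordinate analysis only for INJECTIVITY on `C_k`; surjectivity
onto `(ℙ¹_O)_k` is topology.
PROOF. `S := φ(C_k)` is closed (`C_k = range i` closed, `φ` proper), infinite (`i ≫ φ` injective by (2), `Ck ≅ ℙ¹_{k'}` infinite —
`infinite_projectiveLine`) and contained in the closed fibre `(ℙ¹_O)_k`, which is the image of the base-change closed immersion
`ι : ℙ¹_κ → ℙ¹_O` (`κ` the residue field; `ProjBaseChangeRing.isPullback_projMap'`, Liu 2002 Ex. 3.1.10). In `ℙ¹_κ` every point other than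
the generic point is CLOSED (closed points have `1`-dimensional local rings — res-L1-w45b-stub-3's `ringKrullDim_stalk_eq_of_iso_projectiveSpace` —
and the dimension drops strictly under generization, Stacks 02IZ), so the closed `ι⁻¹(S)` either contains the generic point (then it is
everything and `S = (ℙ¹_O)_k`) or consists of pairwise incomparable points and is FINITE (`Set.Finite.of_forall_specializes_eq`) — impossible.

References (tree): res-D-pv-035 (M-b) `Literature/…/ProperGenericFibreDim` (`one_le_ringKrullDim_stalk_of_ne_genericPoint`); `isIntegral_PP`
(`…NatF102IsoOfCharts`); `Motives.ProjBaseChangeRing.isPullback_projMap'`; `infinite_projectiveLine` (`…NatRationalCarrierInfinite`); res-type-100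
`…NatModelStep`; res-L1-w45b-stub-3 `…NatCentreCodimTwoAdapters`; Literature `AlterationsSemiStableCodimTwo` (`ringKrullDim_stalk_lt_of_specializes`,
`Set.Finite.of_forall_specializes_eq`). [cite: Liu2002, Ex. 3.1.10] [cite: StacksProject, Tag 02IZ]
-/

set_option linter.dupNamespace false -- mandated namespace `Summit.<Summit>.<Problem>` of this single-conjunct summit

noncomputable section

open CategoryTheory AlgebraicGeometry TopologicalSpace Topology IsLocalRing
open Literature.AlgebraicGeometry.Morphisms Literature.AlgebraicGeometry
open Literature.AlgebraicGeometry.Morphisms (ProjCech.PP ProjCech.toSpec)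
open Summit.ResolutionOfSingularities.ResolutionOfSingularities.Cruxes.EquisingularLiftNat.Sections

namespace Summit.ResolutionOfSingularities.ResolutionOfSingularities.Cruxes.EquisingularLiftNat.F102

/-- **In `ℙ¹` over a field every point other than the generic point is closed**: the closed points have `1`-dimensional local rings
(Görtz–Wedhorn I, Lemma 6.26, transported: res-L1-w45b-stub-3's `ringKrullDim_stalk_eq_of_iso_projectiveSpace`), every point specialises to
a closed point, and the dimension drops strictly under a proper generization (Stacks 02IZ) — so a non-closed point has a `0`-dimensional local
ring, i.e. is the generic point. [cite: StacksProject, Tag 02IZ] [cite: GortzWedhorn2020, Lemma 6.26] [OURS · L1 W4.5b · (T-j) glue] -/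
theorem isClosed_singleton_of_ne_genericPoint_PP (κ : Type) [Field κ] (q : ↥(ProjCech.PP κ 1))
    (hq : q ≠ genericPoint ↥(ProjCech.PP κ 1)) : IsClosed ({q} : Set ↥(ProjCech.PP κ 1)) := by
  haveI : IsIntegral (ProjCech.PP κ 1) := isIntegral_PP κ
  haveI : IsProper (ProjCech.toSpec κ 1) := Motives.ProjBaseChangeRing.isProper_projToSpec (Fin (1 + 1)) κ
  haveI : IsLocallyNoetherian (ProjCech.PP κ 1) := LocallyOfFiniteType.isLocallyNoetherian (ProjCech.toSpec κ 1)
  haveI : CompactSpace ↥(ProjCech.PP κ 1) := QuasiCompact.compactSpace_of_compactSpace (ProjCech.toSpec κ 1)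
  obtain ⟨c, hcq, hccl⟩ := (isClosed_closure (s := ({q} : Set ↥(ProjCech.PP κ 1)))).exists_closed_singleton ⟨q, subset_closure rfl⟩
  have hqc : q ⤳ c := specializes_iff_mem_closure.mpr hcq
  by_cases hne : q = c
  · subst hne; exact hccl
  · exfalso
    have h1 : ringKrullDim ((ProjCech.PP κ 1).presheaf.stalk c) = ((1 : ℕ) : WithBot ℕ∞) :=
      ringKrullDim_stalk_eq_of_iso_projectiveSpace 1 (Iso.refl _) c hccl
    have h2 : (1 : WithBot ℕ∞) ≤ ringKrullDim ((ProjCech.PP κ 1).presheaf.stalk q) :=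
      one_le_ringKrullDim_stalk_of_ne_genericPoint q hq
    have h3 := Resolution.ringKrullDim_stalk_lt_of_specializes hqc hne
    have h4 : (1 : WithBot ℕ∞) < ((1 : ℕ) : WithBot ℕ∞) := (h2.trans_lt h3).trans_le h1.le
    exact absurd h4 (by decide)

/-- **A closed infinite subset of the closed fibre of `ℙ¹_O` (`O` local) is the whole closed fibre.** The closed fibre is the image of the
base-change closed immersion `ι : ℙ¹_κ → ℙ¹_O` (Liu 2002, Ex. 3.1.10); the closed preimage `ι⁻¹(S)` either contains the generic point of
`ℙ¹_κ` — then it is everything — or consists of closed, pairwise incomparable points and is finite (maximal points of a closed subset of a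
Noetherian sober space). [cite: Liu2002, Ex. 3.1.10] [cite: StacksProject, Tag 0052] [OURS · L1 W4.5b · (T-j) glue] -/
theorem eq_closedFibre_PP_of_isClosed_of_infinite (O : Type) [CommRing O] [IsLocalRing O] {S : Set ↥(ProjCech.PP O 1)}
    (hS : IsClosed S) (hSinf : S.Infinite) (hSk : S ⊆ (ProjCech.toSpec O 1).base ⁻¹' {closedPoint O}) :
    S = (ProjCech.toSpec O 1).base ⁻¹' {closedPoint O} := by
  letI := (IsLocalRing.residue O).toAlgebra
  -- the closed fibre as the image of `ι : ℙ¹_κ → ℙ¹_O`, for ANY cartesian square over `Spec κ → Spec O`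
  have key : ∀ {P' : Scheme.{0}} [IsIntegral P'] (ι : P' ⟶ ProjCech.PP O 1) (s : P' ⟶ Spec (.of (IsLocalRing.ResidueField O))),
      IsPullback ι s (ProjCech.toSpec O 1) (Spec.map (CommRingCat.ofHom (algebraMap O (IsLocalRing.ResidueField O)))) →
      IsLocallyNoetherian P' → CompactSpace ↥P' →
      (∀ q : P', q ≠ genericPoint ↥P' → IsClosed ({q} : Set ↥P')) →
      S = (ProjCech.toSpec O 1).base ⁻¹' {closedPoint O} := by
    intro P' _ ι s hsq hnoeth hcpt hclosed
    haveI := hnoeth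
    haveI := hcpt
    haveI : IsNoetherian P' := {}
    haveI : IsClosedImmersion (Spec.map (CommRingCat.ofHom (algebraMap O (IsLocalRing.ResidueField O)))) :=
      IsClosedImmersion.spec_of_surjective _ IsLocalRing.residue_surjective
    haveI : IsClosedImmersion ι := MorphismProperty.IsStableUnderBaseChange.of_isPullback hsq.flip inferInstance
    have hrange : Set.range ι.base = (ProjCech.toSpec O 1).base ⁻¹' {closedPoint O} := by
      rw [range_eq_preimage_of_isPullback hsq,
        range_specMap_of_surjective_of_field (algebraMap O (IsLocalRing.ResidueField O)) IsLocalRing.residue_surjective]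
    refine le_antisymm hSk ?_
    -- `T := ι⁻¹ S` is closed; `S = ι '' T`
    set T : Set ↥P' := ι.base ⁻¹' S with hT
    have hTcl : IsClosed T := hS.preimage ι.continuous
    have hST : S = ι.base '' T := by
      refine le_antisymm (fun p hp => ?_) ?_
      · have hp' : p ∈ Set.range ι.base := by rw [hrange]; exact hSk hp
        obtain ⟨q, rfl⟩ := hp'
        exact ⟨q, hp, rfl⟩
      · rintro _ ⟨q, hq, rfl⟩; exact hq
    by_cases hgen : genericPoint ↥P' ∈ T
    · -- `T` contains the generic point, hence is everything
      have hTuniv : T = Set.univ := by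
        refine Set.eq_univ_of_univ_subset ?_
        rw [← genericPoint_closure]
        exact hTcl.closure_subset_iff.mpr (Set.singleton_subset_iff.mpr hgen)
      rw [← hrange, hST, hTuniv, Set.image_univ]
    · -- otherwise `T` is a closed set of closed points, hence finite — contradicting `S` infinite
      exfalso
      have hTfin : T.Finite := by
        refine Resolution.Set.Finite.of_forall_specializes_eq hTcl subset_rfl fun x hx y hy hyx => ?_
        have hycl : IsClosed ({y} : Set ↥P') := hclosed y (fun h => hgen (h ▸ hy))
        have hmem : x ∈ closure ({y} : Set ↥P') := specializes_iff_mem_closure.mp hyx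
        rw [hycl.closure_eq] at hmem
        exact (Set.mem_singleton_iff.mp hmem).symm
      exact hSinf (hST ▸ hTfin.image ι.base)
  haveI : IsIntegral (ProjCech.PP (IsLocalRing.ResidueField O) 1) := isIntegral_PP (IsLocalRing.ResidueField O)
  haveI : IsProper (ProjCech.toSpec (IsLocalRing.ResidueField O) 1) :=
    Motives.ProjBaseChangeRing.isProper_projToSpec (Fin (1 + 1)) (IsLocalRing.ResidueField O)
  haveI : IsLocallyNoetherian (ProjCech.PP (IsLocalRing.ResidueField O) 1) :=
    LocallyOfFiniteType.isLocallyNoetherian (ProjCech.toSpec (IsLocalRing.ResidueField O) 1)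
  haveI : CompactSpace ↥(ProjCech.PP (IsLocalRing.ResidueField O) 1) :=
    QuasiCompact.compactSpace_of_compactSpace (ProjCech.toSpec (IsLocalRing.ResidueField O) 1)
  exact key _ _ (Motives.ProjBaseChangeRing.isPullback_projMap' O (IsLocalRing.ResidueField O) (n := 1))
    inferInstance inferInstance (isClosed_singleton_of_ne_genericPoint_PP (IsLocalRing.ResidueField O))

/-- **S5b conjunct (3) from conjunct (2): `range (i ≫ φ) = (ℙ¹_O)_k`.** In the F-102 setting (`O` local, `θ : O ↠ k`, `f : C → Spec O`
proper, closed fibre `i : Ck → C` cartesian over `Spec θ` with `Ck ≅ ℙ¹_{k'}`) a morphism `φ : C → ℙ¹_O` over `Spec O` whose fibres over the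
closed fibre have at most one point maps `C_k` ONTO `(ℙ¹_O)_k`: `φ(C_k)` is closed (`φ` proper), infinite (`i ≫ φ` injective, `ℙ¹_{k'}`
infinite) and inside the closed fibre, so it is the closed fibre (`eq_closedFibre_PP_of_isClosed_of_infinite`). The conclusion is VERBATIM
conjunct (3) of res-L1-w45b-lead-2's `F102.exists_morphism_PP` (skeleton v3). [cite: Liu2002, Ex. 3.1.10] [cite: StacksProject, Tag 0052]
[OURS · L1 W4.5b · LINE (T-j)-PROOF brick S5b (3)] toward F-102 `GenusZeroOverCompleteDVR_holds` (residue (T-j) of stmt-ResolutionOfSingularities-20148);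
NOT a statement of the manuscript. -/
theorem range_comp_eq_closedFibre_of_subsingleton_fibres (O : Type) [CommRing O] [IsLocalRing O] (k : Type) [Field k] (θ : O →+* k)
    (C : Scheme.{0}) (f : C ⟶ Spec (.of O)) [IsProper f] (Ck : Scheme.{0}) (i : Ck ⟶ C) (t : Ck ⟶ Spec (.of k))
    (hθ : Function.Surjective θ) (hsq : IsPullback i t f (Spec.map (CommRingCat.ofHom θ)))
    (hP1 : ∃ (k' : Type) (_ : Field k'), Nonempty (Ck ≅ ProjCech.PP k' 1))
    (φ : C ⟶ ProjCech.PP O 1) (hφ : φ ≫ ProjCech.toSpec O 1 = f)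
    (hinj : ∀ y : ProjCech.PP O 1, ProjCech.toSpec O 1 y = closedPoint O → (φ.base ⁻¹' {y}).Subsingleton) :
    Set.range (i ≫ φ).base = (ProjCech.toSpec O 1).base ⁻¹' {closedPoint O} := by
  -- `φ` is proper, `i` a closed immersion onto the closed fibre
  haveI : IsProper (ProjCech.toSpec O 1) := Motives.ProjBaseChangeRing.isProper_projToSpec (Fin (1 + 1)) O
  haveI : IsProper (φ ≫ ProjCech.toSpec O 1) := by rw [hφ]; infer_instance
  haveI : IsProper φ := IsProper.of_comp φ (ProjCech.toSpec O 1)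
  haveI : IsClosedImmersion (Spec.map (CommRingCat.ofHom θ)) := IsClosedImmersion.spec_of_surjective _ hθ
  haveI : IsClosedImmersion i := MorphismProperty.IsStableUnderBaseChange.of_isPullback hsq.flip inferInstance
  have hfx : ∀ x : C, f x = ProjCech.toSpec O 1 (φ x) := fun x => by rw [← hφ]; rfl
  have hrangei : Set.range i = f ⁻¹' {closedPoint O} := by
    rw [range_eq_preimage_of_isPullback hsq, range_specMap_of_surjective_of_field θ hθ]
  -- the image lies in the closed fibre
  have hsub : Set.range (i ≫ φ).base ⊆ (ProjCech.toSpec O 1).base ⁻¹' {closedPoint O} := by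
    rintro _ ⟨a, rfl⟩
    have ha : f (i a) = closedPoint O := by
      have h1 : i a ∈ Set.range i := ⟨a, rfl⟩
      rw [hrangei] at h1
      exact h1
    have hpa : (i ≫ φ).base a = φ (i a) := by
      simp only [Scheme.Hom.comp_base, TopCat.coe_comp, Function.comp_apply]
    show ProjCech.toSpec O 1 ((i ≫ φ).base a) = closedPoint O
    rw [hpa, ← hfx]; exact ha
  -- it is closed
  have hcl : IsClosed (Set.range (i ≫ φ).base) := by
    have h : Set.range (i ≫ φ).base = φ.base '' Set.range i.base := by
      rw [Scheme.Hom.comp_base, TopCat.coe_comp, Set.range_comp]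
    rw [h]
    exact φ.isClosedMap _ i.isClosedEmbedding.isClosed_range
  -- and infinite: `i ≫ φ` is injective and `Ck ≅ ℙ¹_{k'}` is infinite
  have hinjφ : Function.Injective (i ≫ φ).base := by
    intro a b hab
    have ha : f (i a) = closedPoint O := by
      have h1 : i a ∈ Set.range i := ⟨a, rfl⟩
      rw [hrangei] at h1
      exact h1
    have hy : ProjCech.toSpec O 1 (φ (i a)) = closedPoint O := by rw [← hfx]; exact ha
    have hab' : φ (i a) = φ (i b) := by
      simpa only [Scheme.Hom.comp_base, TopCat.coe_comp, Function.comp_apply] using hab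
    have h := hinj (φ (i a)) hy (show i a ∈ φ.base ⁻¹' {φ (i a)} from rfl)
      (show i b ∈ φ.base ⁻¹' {φ (i a)} from hab'.symm)
    exact i.isClosedEmbedding.injective h
  have hinf : (Set.range (i ≫ φ).base).Infinite := by
    obtain ⟨k', _, ⟨e⟩⟩ := hP1
    haveI : Infinite ↥(ProjCech.PP k' 1) := infinite_projectiveLine k'
    haveI : Infinite ↥Ck := Infinite.of_injective e.inv.base e.inv.isOpenEmbedding.injective
    exact Set.infinite_range_of_injective hinjφ
  exact eq_closedFibre_PP_of_isClosed_of_infinite O hcl hinf hsub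

end Summit.ResolutionOfSingularities.ResolutionOfSingularities.Cruxes.EquisingularLiftNat.F102

end
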